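import Mathlib
import Literature.NumberTheory.Sieve.SieveFrameworkFundamentalLemma
import Literature.NumberTheory.Sieve.ParityBarrierProofs
import Literature.NumberTheory.Sieve.ParityBarrierLevelProofs
import Summits.Parity.GeneralizedHardyLittlewood.Theorems.ParityLeakOneFifthPlainSplitRoughMass
import Summits.Parity.GeneralizedHardyLittlewood.Theorems.ParityLeakOneFifthPlainSplitCalibTools
import HarnessLib

/-!
# Route ParityLeakOneFifth, crux `PlainSplit` (stmt-Parity-18382), skeleton `calib-split`:
# stub `stub_twistedPrimesLower` — `#{n ∈ (x,2x] : n z-rough, n+2 prime} ≥ (1−δ)·V_sh·x/log x`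

`z = exp((log log x)²)`, `V_sh = ∏_{2<p<z}(1 − 1/(p−1))`.  All inputs are tree theorems: the shifted
primes `Λ(n+2)` are the sifted sequence `SieveSequence.shiftedPrimes 2` (dimension `1`:
`hasSieveDimension_shiftedPrimes_two_one_holds`; density product `V_sh`:
`densityProduct_shiftedPrimes_two`; level of distribution `x^θ`, `θ < 1/2`, i.e. Bombieri–Vinogradov
+ PNT: `shiftedPrimes_hasLevelOfDistribution_holds`); the uniform fundamental lemma
`SieveSequence.fundamental_lemma_uniform_holds` at level `z^s ≤ x^{1/8}` (`3Ce^{−s} ≤ δ/4`) bounds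
the window sum `Σ_{x<n≤2x, (n,P(z))=1} Λ(n+2)` below; prime powers are discarded with Mathlib's
`|ψ − θ| ≤ 2√X log X`, and the errors are absorbed using `V_sh ≥ c/(log log x)⁴` (`exists_Vsh_lower`).
-/

namespace Summit.Parity.GeneralizedHardyLittlewood.Theorems.ParityLeakOneFifth

open Finset Real
open scoped ArithmeticFunction.vonMangoldt Chebyshev
open Literature.NumberTheory.Sieve

/-! ### Dictionary -/

/-- `z`-rough in the route's form iff coprime to `P(z)`, for `n ≠ 0`. -/
theorem rough_iff_coprime {n : ℕ} (hn : n ≠ 0) (z : ℝ) :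
    (∀ p ∈ n.primeFactors, z ≤ (p : ℝ)) ↔ n.Coprime (primesProdBelow z) := by
  rw [coprime_primesProdBelow_iff]
  constructor
  · intro h q hq hdvd
    rw [Nat.mem_primesBelow] at hq
    have := h q (Nat.mem_primeFactors.2 ⟨hq.2, hdvd, hn⟩)
    exact absurd (Nat.lt_ceil.1 hq.1) (not_lt.2 this)
  · intro h p hp
    obtain ⟨hpr, hdvd, -⟩ := Nat.mem_primeFactors.1 hp
    by_contra hlt
    rw [not_le] at hlt
    exact h p (Nat.mem_primesBelow.2 ⟨Nat.lt_ceil.2 hlt, hpr⟩) hdvd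

/-- The sifted sum of the shifted primes at an integer height: `S(𝒜, P; N) = Σ_{n ≤ N, (n,P)=1} Λ(n+2)`. -/
theorem sifted_shiftedPrimes_natCast (N : ℕ) (P : ℕ) :
    (SieveSequence.shiftedPrimes 2).sifted (N : ℝ) P =
      ∑ n ∈ (Finset.Ioc 0 N).filter (fun n : ℕ => n.Coprime P), Λ (n + 2) := by
  simp only [SieveSequence.sifted, Nat.floor_natCast]
  rfl

/-- The non-prime part of `ψ`: `Σ_{m ≤ N, m not prime} Λ(m) = ψ(N) − θ(N)`. -/
theorem sum_vonMangoldt_not_prime (N : ℕ) :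
    ∑ m ∈ (Finset.Ioc 0 N).filter (fun m : ℕ => ¬ m.Prime), Λ m = ψ (N : ℝ) - θ (N : ℝ) := by
  rw [Chebyshev.psi, Chebyshev.theta, Nat.floor_natCast]
  have hsplit := Finset.sum_filter_add_sum_filter_not (Finset.Ioc 0 N) (fun m : ℕ => m.Prime)
    (fun m => Λ m)
  have hθ : ∑ m ∈ (Finset.Ioc 0 N).filter (fun m : ℕ => m.Prime), Λ m =
      ∑ m ∈ (Finset.Ioc 0 N).filter (fun m : ℕ => m.Prime), Real.log m :=
    Finset.sum_congr rfl fun m hm =>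
      ArithmeticFunction.vonMangoldt_apply_prime (Finset.mem_filter.1 hm).2
  linarith

/-- The final arithmetic of `stub_twistedPrimesLower`, over real variables. -/
theorem twistedPrimes_arith {δ E x V W P L L₂ Q Sq : ℝ} (hδ : 0 < δ) (hδ1 : δ < 1)
    (hWlow : x * V * (1 - E) - 3 * Q ≤ W) (hWup : W ≤ L₂ * P + Sq) (hSq : Sq ≤ δ / 8 * (V * x))
    (hQ : 3 * Q ≤ δ / 8 * (V * x)) (hE : E * (V * x) ≤ δ / 4 * (V * x))
    (hL₂ : L₂ ≤ (1 + δ / 4) * L) (hL : 0 < L) (hVx : 0 ≤ V * x) (hP : 0 ≤ P) :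
    (1 - δ) * V * x / L ≤ P := by
  have h1 : (1 - δ / 2) * (V * x) ≤ L₂ * P := by
    have : x * V * (1 - E) = V * x - E * (V * x) := by ring
    linarith
  have h2 : L₂ * P ≤ (1 + δ / 4) * L * P := mul_le_mul_of_nonneg_right hL₂ hP
  have h3 : (1 - δ) * (1 + δ / 4) ≤ 1 - δ / 2 := by nlinarith
  have h4 : (1 - δ) * (1 + δ / 4) * (V * x) ≤ (1 - δ / 2) * (V * x) :=
    mul_le_mul_of_nonneg_right h3 hVx
  rw [div_le_iff₀ hL]
  have h5 : (1 - δ) * (V * x) * (1 + δ / 4) ≤ (L * P) * (1 + δ / 4) := by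
    calc (1 - δ) * (V * x) * (1 + δ / 4) = (1 - δ) * (1 + δ / 4) * (V * x) := by ring
      _ ≤ (1 - δ / 2) * (V * x) := h4
      _ ≤ L₂ * P := h1
      _ ≤ (1 + δ / 4) * L * P := h2
      _ = (L * P) * (1 + δ / 4) := by ring
  have h6 := le_of_mul_le_mul_right h5 (by linarith : (0 : ℝ) < 1 + δ / 4)
  calc (1 - δ) * V * x = (1 - δ) * (V * x) := by ring
    _ ≤ L * P := h6
    _ = P * L := by ring

/-! ### The stub -/

/-- **Stub `stub_twistedPrimesLower` of skeleton `calib-split` of crux `PlainSplit`** (registered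
signature, verbatim): for every `δ > 0` and large `x`, the `n ∈ (x, 2x]` with `n` `z`-rough and
`n + 2` prime number at least `(1 − δ)·V_sh·x/log x` (FL lower bound for `SieveSequence.shiftedPrimes 2`
at level `z^s ≤ x^{1/8}`; remainders by its proved level of distribution; prime powers by `ψ − θ`). -/
theorem stub_twistedPrimesLower : ∀ δ : ℝ, 0 < δ → ∃ x₀ : ℕ, ∀ x : ℕ, x₀ ≤ x → ∀ (z Vsh : ℝ), z = Real.exp (Real.log (Real.log (x : ℝ)) ^ 2) → Vsh = ∏ p ∈ (Finset.range ⌈z⌉₊).filter (fun p : ℕ => p.Prime ∧ p ≠ 2), (1 - 1 / ((p : ℝ) - 1)) → (1 - δ) * Vsh * (x : ℝ) / Real.log (x : ℝ) ≤ #((Finset.Ioc x (2 * x)).filter (fun n : ℕ => (∀ p ∈ n.primeFactors, z ≤ (p : ℝ)) ∧ (n + 2).Prime)) := by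
  intro δ hδ
  by_cases hδ1 : 1 ≤ δ
  · refine ⟨0, fun x _ => ?_⟩
    intro z Vsh hz hVsh
    refine le_trans ?_ (Nat.cast_nonneg _)
    have hV : 0 ≤ Vsh := by
      rw [hVsh]
      refine Finset.prod_nonneg fun p hp => ?_
      obtain ⟨-, hpr, hne⟩ := Finset.mem_filter.1 hp
      have h3' : 3 ≤ p := by have := hpr.two_le; omega
      have h3 : (3 : ℝ) ≤ p := by exact_mod_cast h3'
      rw [sub_nonneg, div_le_one (by linarith)]; linarith
    have hlog : 0 ≤ Real.log (x : ℝ) := Real.log_natCast_nonneg x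
    apply div_nonpos_of_nonpos_of_nonneg _ hlog
    have h2 : 0 ≤ (δ - 1) * (Vsh * x) := mul_nonneg (by linarith) (mul_nonneg hV (Nat.cast_nonneg _))
    linarith
  rw [not_le] at hδ1
  obtain ⟨K, hdim⟩ := hasSieveDimension_shiftedPrimes_two_one_holds
  obtain ⟨C, hC, hFL⟩ := SieveSequence.fundamental_lemma_uniform_holds 1 K
  obtain ⟨c, hc, hVshlow⟩ := exists_Vsh_lower
  have hlev := (shiftedPrimes_hasLevelOfDistribution_holds (1 / 4) (by norm_num)) (1 / 8)
    (by norm_num) 2 (by norm_num)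
  obtain ⟨cR, hcR⟩ := hlev.bound
  obtain ⟨XR, hXR⟩ := Filter.eventually_atTop.1 hcR
  set CR : ℝ := max cR 1 with hCRdef
  have hCR1 : 1 ≤ CR := le_max_right _ _
  have hCR0 : 0 < CR := by linarith
  obtain ⟨s, hs1, hsC⟩ : ∃ s : ℝ, 1 ≤ s ∧ 3 * C * Real.exp (-s) ≤ δ / 4 := by
    refine ⟨max 1 (Real.log (12 * C / δ)), le_max_left _ _, ?_⟩
    have h1 : Real.exp (-max 1 (Real.log (12 * C / δ))) ≤ Real.exp (-Real.log (12 * C / δ)) :=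
      Real.exp_le_exp.2 (neg_le_neg (le_max_right _ _))
    rw [Real.exp_neg (Real.log _), Real.exp_log (by positivity)] at h1
    calc 3 * C * Real.exp (-max 1 (Real.log (12 * C / δ)))
        ≤ 3 * C * (12 * C / δ)⁻¹ := mul_le_mul_of_nonneg_left h1 (by positivity)
      _ = δ / 4 := by field_simp; ring
  obtain ⟨T₁, hT₁1, hT₁⟩ := exists_quadratic_le_exp (8 * s) 0 0
  obtain ⟨T₂, -, hT₂⟩ := exists_pow_four_le_mul_exp (κ := δ * c / (24 * CR)) (by positivity)
  obtain ⟨T₃, -, hT₃⟩ := exists_quadratic_le_exp 0 10 (2 * Real.log (64 / (δ * c)))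
  obtain ⟨T₄, -, hT₄⟩ := exists_quadratic_le_exp 0 0 (4 * Real.log 4 / δ)
  obtain ⟨x₁, hx₁⟩ := exists_nat_loglog_ge (max (max T₁ T₂) (max T₃ T₄))
  refine ⟨max x₁ ⌈XR⌉₊, fun x hx => ?_⟩
  rintro z Vsh rfl rfl
  obtain ⟨hxE, hlogx, hTt⟩ := hx₁ x (le_trans (le_max_left _ _) hx)
  have hxXR : XR ≤ (x : ℝ) := (Nat.le_ceil XR).trans (by exact_mod_cast le_trans (le_max_right _ _) hx)
  set t : ℝ := Real.log (Real.log (x : ℝ)) with ht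
  have hT₁t : T₁ ≤ t := le_trans ((le_max_left _ _).trans (le_max_left _ _)) hTt
  have hT₂t : T₂ ≤ t := le_trans ((le_max_right _ _).trans (le_max_left _ _)) hTt
  have hT₃t : T₃ ≤ t := le_trans ((le_max_left _ _).trans (le_max_right _ _)) hTt
  have hT₄t : T₄ ≤ t := le_trans ((le_max_right _ _).trans (le_max_right _ _)) hTt
  have ht1 : 1 ≤ t := hT₁1.trans hT₁t
  have ht0 : 0 ≤ t := by linarith
  have hx0 : (0 : ℝ) < x := (Real.exp_pos _).trans_le hxE
  have hx1 : (1 : ℝ) ≤ x := (Real.one_le_exp (Real.exp_pos _).le).trans hxE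
  have hlogpos : 0 < Real.log (x : ℝ) := (Real.exp_pos _).trans_le hlogx
  have hexpt : Real.exp t = Real.log (x : ℝ) := by rw [ht, Real.exp_log hlogpos]
  have hxexp : Real.exp (Real.exp t) = (x : ℝ) := by rw [hexpt, Real.exp_log hx0]
  set z : ℝ := Real.exp (t ^ 2) with hz
  have hz0 : 0 < z := Real.exp_pos _
  have hz2 : 2 < z := by
    have h1 : Real.exp 1 ≤ z := Real.exp_le_exp.2 (by nlinarith)
    have h2 : (2 : ℝ) < Real.exp 1 := by have := Real.exp_one_gt_d9; linarith
    linarith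
  have hz1 : 1 ≤ z := by linarith
  have hlogz : Real.log z = t ^ 2 := by rw [hz, Real.log_exp]
  set L : ℝ := z ^ s with hL
  have hL0 : 0 < L := Real.rpow_pos_of_pos hz0 s
  have hzL : z ≤ L := by
    calc z = z ^ (1 : ℝ) := (Real.rpow_one z).symm
      _ ≤ z ^ s := Real.rpow_le_rpow_of_exponent_le hz1 hs1
  have hlogL : Real.log L / Real.log z = s := by
    rw [hL, Real.log_rpow hz0, hlogz]; field_simp
  have hLexp : L = Real.exp (s * t ^ 2) := by rw [hL, hz, ← Real.exp_mul]; ring_nf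
  have hLx : L ≤ (x : ℝ) ^ ((1 : ℝ) / 8) := by
    have h := hT₁ t hT₁t
    rw [hLexp, ← hxexp, ← Real.exp_mul]
    exact Real.exp_le_exp.2 (by nlinarith)
  set Vsh : ℝ := ∏ p ∈ (Finset.range ⌈z⌉₊).filter (fun p : ℕ => p.Prime ∧ p ≠ 2),
    (1 - 1 / ((p : ℝ) - 1)) with hVsh
  have hVshc : c / t ^ 4 ≤ Vsh := by
    have h := hVshlow z hz2
    rw [hlogz, show (t ^ 2) ^ 2 = t ^ 4 by ring] at h
    exact h
  have ht4 : 0 < t ^ 4 := by positivity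
  have hVsh0 : 0 < Vsh := lt_of_lt_of_le (div_pos hc ht4) hVshc
  set A := SieveSequence.shiftedPrimes 2 with hA
  have hsize : ∀ X : ℝ, A.size X = X := fun X => rfl
  have hdens : A.densityProduct (primesProdBelow z) = Vsh := densityProduct_shiftedPrimes_two z
  -- remainders at height `X ≥ x`: `Σ_{d ∣ P(z), d ≤ L} |R_d(X)| ≤ CR X / log² X`
  have hrem : ∀ X : ℝ, (x : ℝ) ≤ X →
      ∑ d ∈ (primesProdBelow z).divisors.filter (fun d : ℕ => (d : ℝ) ≤ L), |A.remainder d X| ≤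
        CR * X / Real.log X ^ 2 := by
    intro X hX
    have hX1 : 1 ≤ X := hx1.trans hX
    have hX0 : 0 < X := by linarith
    have hlogX : 0 < Real.log X := by
      have : Real.log (x : ℝ) ≤ Real.log X := Real.log_le_log hx0 hX
      linarith
    have h := hXR X (hxXR.trans hX)
    rw [Real.norm_eq_abs, Real.norm_eq_abs, hsize] at h
    have hsub : (primesProdBelow z).divisors.filter (fun d : ℕ => (d : ℝ) ≤ L) ⊆
        (Finset.Icc 1 ⌊X ^ ((1 : ℝ) / 4 - 1 / 8)⌋₊).filter Squarefree := by
      intro d hd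
      rw [Finset.mem_filter] at hd ⊢
      have hdv := Nat.mem_divisors.1 hd.1
      refine ⟨Finset.mem_Icc.2 ⟨Nat.pos_of_mem_divisors hd.1, Nat.le_floor ?_⟩,
        (squarefree_primesProdBelow z).squarefree_of_dvd hdv.1⟩
      have hX8 : (x : ℝ) ^ ((1 : ℝ) / 8) ≤ X ^ ((1 : ℝ) / 4 - 1 / 8) := by
        rw [show (1 : ℝ) / 4 - 1 / 8 = 1 / 8 by norm_num]
        exact Real.rpow_le_rpow hx0.le hX (by norm_num)
      exact hd.2.trans (hLx.trans hX8)
    have hle := Finset.sum_le_sum_of_subset_of_nonneg hsub (fun d _ _ => abs_nonneg (A.remainder d X))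
    have habs : |(∑ d ∈ (Finset.Icc 1 ⌊X ^ ((1 : ℝ) / 4 - 1 / 8)⌋₊).filter Squarefree,
        |A.remainder d X|)| = ∑ d ∈ (Finset.Icc 1 ⌊X ^ ((1 : ℝ) / 4 - 1 / 8)⌋₊).filter Squarefree,
        |A.remainder d X| := abs_of_nonneg (Finset.sum_nonneg fun d _ => abs_nonneg _)
    rw [habs] at h
    have hg : |X / Real.log X ^ (2 : ℝ)| = X / Real.log X ^ 2 := by
      rw [Real.rpow_two, abs_of_nonneg (by positivity)]
    rw [hg] at h
    calc ∑ d ∈ (primesProdBelow z).divisors.filter (fun d : ℕ => (d : ℝ) ≤ L), |A.remainder d X|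
        ≤ _ := hle
      _ ≤ cR * (X / Real.log X ^ 2) := h
      _ ≤ CR * (X / Real.log X ^ 2) := mul_le_mul_of_nonneg_right (le_max_left _ _) (by positivity)
      _ = CR * X / Real.log X ^ 2 := by ring
  -- the fundamental lemma at heights `2x` and `x`
  have hFL2 := hFL A hdim (2 * (x : ℝ)) z L hz2.le hzL (by rw [hsize]; positivity)
  have hFL1 := hFL A hdim (x : ℝ) z L hz2.le hzL (by rw [hsize]; positivity)
  rw [hsize, hdens, hlogL] at hFL2 hFL1
  have hS2 : A.sifted (2 * (x : ℝ)) (primesProdBelow z) =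
      ∑ n ∈ (Finset.Ioc 0 (2 * x)).filter (fun n : ℕ => n.Coprime (primesProdBelow z)), Λ (n + 2) := by
    rw [show (2 * (x : ℝ)) = ((2 * x : ℕ) : ℝ) by push_cast; ring, sifted_shiftedPrimes_natCast]
  have hS1 : A.sifted (x : ℝ) (primesProdBelow z) =
      ∑ n ∈ (Finset.Ioc 0 x).filter (fun n : ℕ => n.Coprime (primesProdBelow z)), Λ (n + 2) :=
    sifted_shiftedPrimes_natCast x _
  -- the window sum `W = S(2x) − S(x)`
  set W : ℝ := ∑ n ∈ (Finset.Ioc x (2 * x)).filter (fun n : ℕ => n.Coprime (primesProdBelow z)),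
    Λ (n + 2) with hWdef
  have hW : W = A.sifted (2 * (x : ℝ)) (primesProdBelow z) - A.sifted (x : ℝ) (primesProdBelow z) := by
    rw [hS2, hS1, hWdef, Finset.sum_filter, Finset.sum_filter, Finset.sum_filter,
      ← Finset.sum_Ioc_consecutive _ (Nat.zero_le x) (by omega : x ≤ 2 * x)]
    ring
  have hR2 := hrem (2 * (x : ℝ)) (by linarith)
  have hR1 := hrem (x : ℝ) le_rfl
  have hWlow : (x : ℝ) * Vsh * (1 - 3 * C * Real.exp (-s)) - 3 * (CR * x / Real.log x ^ 2) ≤ W := by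
    have h2 := (abs_le.1 hFL2).1
    have h1 := (abs_le.1 hFL1).2
    have hlog2 : Real.log (x : ℝ) ≤ Real.log (2 * x) := Real.log_le_log hx0 (by linarith)
    have hR2' : CR * (2 * (x : ℝ)) / Real.log (2 * x) ^ 2 ≤ 2 * (CR * x / Real.log x ^ 2) := by
      rw [show CR * (2 * (x : ℝ)) / Real.log (2 * x) ^ 2 = 2 * (CR * x / Real.log (2 * x) ^ 2) by ring]
      refine mul_le_mul_of_nonneg_left ?_ (by norm_num)
      exact div_le_div_of_nonneg_left (by positivity) (by positivity)
        (pow_le_pow_left₀ hlogpos.le hlog2 2)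
    rw [hW]
    linarith [h2, h1, hR2, hR1, hR2']
  -- `W ≤ log(2x+2)·#P + (ψ − θ)(2x+2)`
  set Pset := (Finset.Ioc x (2 * x)).filter
    (fun n : ℕ => (∀ p ∈ n.primeFactors, z ≤ (p : ℝ)) ∧ (n + 2).Prime) with hPset
  have hWup : W ≤ Real.log (2 * x + 2) * #Pset + 2 * Real.sqrt (2 * x + 2) * Real.log (2 * x + 2) := by
    have hcop : (Finset.Ioc x (2 * x)).filter (fun n : ℕ => n.Coprime (primesProdBelow z)) =
        (Finset.Ioc x (2 * x)).filter (fun n : ℕ => ∀ p ∈ n.primeFactors, z ≤ (p : ℝ)) :=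
      Finset.filter_congr fun n hn => (rough_iff_coprime (by
        have := (Finset.mem_Ioc.1 hn).1; omega) z).symm
    rw [hWdef, hcop, ← Finset.sum_filter_add_sum_filter_not _ (fun n : ℕ => (n + 2).Prime)]
    rw [Finset.filter_filter]
    have hA1 : ∑ n ∈ Pset, Λ (n + 2) ≤ Real.log (2 * x + 2) * #Pset := by
      rw [mul_comm, ← nsmul_eq_mul, ← Finset.sum_const]
      refine Finset.sum_le_sum fun n hn => ?_
      have hn2 := (Finset.mem_Ioc.1 (Finset.mem_filter.1 hn).1).2
      calc Λ (n + 2) ≤ Real.log ((n + 2 : ℕ) : ℝ) := ArithmeticFunction.vonMangoldt_le_log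
        _ ≤ Real.log (2 * x + 2) := Real.log_le_log (by positivity) (by exact_mod_cast (by omega))
    have hA2 : ∑ n ∈ ((Finset.Ioc x (2 * x)).filter (fun n : ℕ => ∀ p ∈ n.primeFactors,
        z ≤ (p : ℝ))).filter (fun n : ℕ => ¬ (n + 2).Prime), Λ (n + 2) ≤
        2 * Real.sqrt (2 * x + 2) * Real.log (2 * x + 2) := by
      have hsub : (((Finset.Ioc x (2 * x)).filter (fun n : ℕ => ∀ p ∈ n.primeFactors,
          z ≤ (p : ℝ))).filter (fun n : ℕ => ¬ (n + 2).Prime)).map (addRightEmbedding 2) ⊆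
          (Finset.Ioc 0 (2 * x + 2)).filter (fun m : ℕ => ¬ m.Prime) := by
        intro m hm
        rw [Finset.mem_map] at hm
        obtain ⟨n, hn, rfl⟩ := hm
        rw [Finset.mem_filter] at hn ⊢
        have hn' := Finset.mem_Ioc.1 (Finset.mem_filter.1 hn.1).1
        exact ⟨Finset.mem_Ioc.2 ⟨by simp, by simp [addRightEmbedding_apply]; omega⟩, hn.2⟩
      have h1 : ∑ n ∈ ((Finset.Ioc x (2 * x)).filter (fun n : ℕ => ∀ p ∈ n.primeFactors,
          z ≤ (p : ℝ))).filter (fun n : ℕ => ¬ (n + 2).Prime), Λ (n + 2) =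
          ∑ m ∈ (((Finset.Ioc x (2 * x)).filter (fun n : ℕ => ∀ p ∈ n.primeFactors,
          z ≤ (p : ℝ))).filter (fun n : ℕ => ¬ (n + 2).Prime)).map (addRightEmbedding 2), Λ m := by
        rw [Finset.sum_map]; rfl
      rw [h1]
      refine (Finset.sum_le_sum_of_subset_of_nonneg hsub
        (fun m _ _ => ArithmeticFunction.vonMangoldt_nonneg)).trans ?_
      rw [sum_vonMangoldt_not_prime]
      have h2x : (1 : ℝ) ≤ ((2 * x + 2 : ℕ) : ℝ) := by push_cast; linarith
      have h := Chebyshev.abs_psi_sub_theta_le_sqrt_mul_log h2x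
      push_cast at h ⊢
      exact (le_abs_self _).trans h
    linarith
  -- absorb the error terms
  have hsqrt : 2 * Real.sqrt (2 * x + 2) * Real.log (2 * x + 2) ≤ δ / 8 * (Vsh * x) := by
    -- `√(2x+2) ≤ 2√x`, `log(2x+2) ≤ 2 log x`, `8 √x log x ≤ (δ/8)(c/t⁴) x`
    have hs1 : Real.sqrt (2 * x + 2) ≤ 2 * Real.sqrt x := by
      rw [show (2 : ℝ) * Real.sqrt x = Real.sqrt (4 * x) by
        rw [Real.sqrt_mul (by norm_num), show Real.sqrt 4 = 2 by
          rw [show (4 : ℝ) = 2 ^ 2 by norm_num, Real.sqrt_sq (by norm_num)]]]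
      exact Real.sqrt_le_sqrt (by linarith)
    have hl4 : Real.log 4 ≤ 2 := by
      have := Real.log_two_lt_d9
      rw [show (4 : ℝ) = 2 ^ 2 by norm_num, Real.log_pow]; push_cast; linarith
    have het : Real.exp 1 ≤ Real.exp t := Real.exp_le_exp.2 ht1
    have he1 : (2 : ℝ) < Real.exp 1 := by have := Real.exp_one_gt_d9; linarith
    have hlog2x : Real.log (2 * x + 2) ≤ 2 * Real.log x := by
      have h4 : Real.log (2 * x + 2) ≤ Real.log 4 + Real.log x := by
        rw [← Real.log_mul (by norm_num) hx0.ne']; exact Real.log_le_log (by positivity) (by linarith)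
      linarith [hexpt]
    have hsx : Real.sqrt x = Real.exp (Real.exp t / 2) := by
      rw [← hxexp, Real.sqrt_eq_rpow, ← Real.exp_mul]; ring_nf
    have h3 := hT₃ t hT₃t
    have h1 : t ^ 4 ≤ Real.exp (4 * t) := by
      have h := Real.add_one_le_exp t
      have h' : t ≤ Real.exp t := by linarith
      calc t ^ 4 ≤ (Real.exp t) ^ 4 := pow_le_pow_left₀ ht0 h' 4
        _ = Real.exp (4 * t) := by rw [← Real.exp_nat_mul]; norm_num
    have hδc : 0 < δ * c := by positivity
    -- `64 t⁴ e^t ≤ δ c e^{E/2}`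
    have key : 64 * t ^ 4 * Real.exp t ≤ δ * c * Real.exp (Real.exp t / 2) := by
      have h4 : Real.exp (Real.log (64 / (δ * c)) + 5 * t) ≤ Real.exp (Real.exp t / 2) :=
        Real.exp_le_exp.2 (by linarith)
      rw [Real.exp_add, Real.exp_log (by positivity)] at h4
      have h5 : 64 * t ^ 4 * Real.exp t ≤ 64 * Real.exp (5 * t) := by
        have : t ^ 4 * Real.exp t ≤ Real.exp (4 * t) * Real.exp t :=
          mul_le_mul_of_nonneg_right h1 (Real.exp_pos t).le
        rw [← Real.exp_add, show 4 * t + t = 5 * t by ring] at this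
        linarith
      have h6 : 64 * Real.exp (5 * t) = δ * c * (64 / (δ * c) * Real.exp (5 * t)) := by
        field_simp
      rw [h6] at h5
      exact h5.trans (mul_le_mul_of_nonneg_left h4 hδc.le)
    calc 2 * Real.sqrt (2 * x + 2) * Real.log (2 * x + 2)
        ≤ 2 * (2 * Real.sqrt x) * (2 * Real.log x) := by
          gcongr
          · exact Real.log_nonneg (by linarith)
      _ = 8 * Real.exp (Real.exp t / 2) * Real.exp t := by rw [hsx, hexpt]; ring
      _ ≤ δ / 8 * (c / t ^ 4) * (Real.exp (Real.exp t / 2) * Real.exp (Real.exp t / 2)) := by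
          rw [show δ / 8 * (c / t ^ 4) * (Real.exp (Real.exp t / 2) * Real.exp (Real.exp t / 2)) =
            (δ * c * Real.exp (Real.exp t / 2)) * Real.exp (Real.exp t / 2) / (8 * t ^ 4) by
              field_simp]
          rw [le_div_iff₀ (by positivity)]
          have := mul_le_mul_of_nonneg_right key (Real.exp_pos (Real.exp t / 2)).le
          calc 8 * Real.exp (Real.exp t / 2) * Real.exp t * (8 * t ^ 4)
              = 64 * t ^ 4 * Real.exp t * Real.exp (Real.exp t / 2) := by ring
            _ ≤ δ * c * Real.exp (Real.exp t / 2) * Real.exp (Real.exp t / 2) := this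
      _ = δ / 8 * (c / t ^ 4) * x := by rw [← Real.exp_add, show Real.exp t / 2 + Real.exp t / 2 = Real.exp t by ring, hxexp]
      _ ≤ δ / 8 * (Vsh * x) := by
          rw [show δ / 8 * (c / t ^ 4) * x = δ / 8 * ((c / t ^ 4) * x) by ring]
          exact mul_le_mul_of_nonneg_left (mul_le_mul_of_nonneg_right hVshc hx0.le) (by positivity)
  have hremabs : 3 * (CR * x / Real.log x ^ 2) ≤ δ / 8 * (Vsh * x) := by
    have h2 := hT₂ t hT₂t
    have hE0 : 0 < Real.exp t := Real.exp_pos t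
    have hE1 : 1 ≤ Real.exp t := by
      have := Real.exp_le_exp.2 ht0; rwa [Real.exp_zero] at this
    have he : Real.exp t ≤ Real.exp t ^ 2 := by
      rw [sq]; exact le_mul_of_one_le_left hE0.le hE1
    have hE2 : (0 : ℝ) < Real.exp t ^ 2 := by positivity
    -- `24 CR t⁴ ≤ δ c e^t ≤ δ c e^{2t}`
    have key : 24 * CR * t ^ 4 ≤ δ * c * Real.exp t ^ 2 := by
      have h := mul_le_mul_of_nonneg_left h2 (by positivity : (0 : ℝ) ≤ 24 * CR)
      have e : 24 * CR * (δ * c / (24 * CR) * Real.exp t) = δ * c * Real.exp t := by field_simp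
      rw [e] at h
      exact h.trans (mul_le_mul_of_nonneg_left he (by positivity))
    have h3 : 3 * CR ≤ δ / 8 * Vsh * Real.exp t ^ 2 := by
      have h5 : δ * c * Real.exp t ^ 2 ≤ δ * (Vsh * t ^ 4) * Real.exp t ^ 2 := by
        have hct : c ≤ Vsh * t ^ 4 := by
          have := mul_le_mul_of_nonneg_right hVshc ht4.le
          rwa [div_mul_cancel₀ _ ht4.ne'] at this
        have := mul_le_mul_of_nonneg_left hct hδ.le
        exact mul_le_mul_of_nonneg_right this hE2.le
      have h6 : 24 * CR * t ^ 4 ≤ (8 * (δ / 8 * Vsh * Real.exp t ^ 2)) * t ^ 4 := by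
        calc 24 * CR * t ^ 4 ≤ δ * (Vsh * t ^ 4) * Real.exp t ^ 2 := key.trans h5
          _ = (8 * (δ / 8 * Vsh * Real.exp t ^ 2)) * t ^ 4 := by ring
      have h7 := le_of_mul_le_mul_right h6 ht4
      linarith
    have hL2 : Real.log (x : ℝ) ^ 2 = Real.exp t ^ 2 := by rw [hexpt]
    rw [hL2]
    calc 3 * (CR * x / Real.exp t ^ 2) = (3 * CR) * (x / Real.exp t ^ 2) := by ring
      _ ≤ (δ / 8 * Vsh * Real.exp t ^ 2) * (x / Real.exp t ^ 2) :=
          mul_le_mul_of_nonneg_right h3 (by positivity)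
      _ = δ / 8 * (Vsh * x) * (Real.exp t ^ 2 / Real.exp t ^ 2) := by ring
      _ = δ / 8 * (Vsh * x) := by rw [div_self hE2.ne', mul_one]
  have hlogratio : Real.log (2 * x + 2) ≤ (1 + δ / 4) * Real.log x := by
    have h4 : Real.log (2 * x + 2) ≤ Real.log 4 + Real.log x := by
      rw [← Real.log_mul (by norm_num) hx0.ne']; exact Real.log_le_log (by positivity) (by linarith)
    have h := hT₄ t hT₄t
    have hl : Real.log 4 ≤ δ / 4 * Real.log x := by
      rw [← hexpt]
      have : 4 * Real.log 4 / δ ≤ Real.exp t := by linarith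
      rw [div_le_iff₀ hδ] at this
      linarith
    linarith
  -- assemble: `(1 − δ) Vsh x / log x ≤ #P`
  have hVx : 0 ≤ Vsh * (x : ℝ) := mul_nonneg hVsh0.le hx0.le
  have hE := mul_le_mul_of_nonneg_right hsC hVx
  exact twistedPrimes_arith hδ hδ1 hWlow hWup hsqrt hremabs hE hlogratio hlogpos hVx
    (Nat.cast_nonneg _)

end Summit.Parity.GeneralizedHardyLittlewood.Theorems.ParityLeakOneFifth
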